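import Literature.NumberTheory.IwasawaTheory.Greenberg2016.GlobalH1AlmostDivisibleOfFacts
import Literature.NumberTheory.IwasawaTheory.Greenberg2006.AlmostDivisibleSpecialisation
import Literature.NumberTheory.IwasawaTheory.Greenberg2006.CohomologyCofiniteGenerationOfPoitouTate
import Literature.NumberTheory.IwasawaTheory.Greenberg2006.CoinducedModuleDual
import Literature.NumberTheory.IwasawaTheory.Greenberg2006.TwistDeformation
import Literature.NumberTheory.EllipticCurves.AnticyclotomicBigGaloisRep
import Literature.NumberTheory.EllipticCurves.Greenberg1999.H1SigmaDualNoFiniteOfTwistSurjective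
import Literature.NumberTheory.EllipticCurves.IwasawaAlgebraPseudoNullProofs
import Summits.BirchSwinnertonDyer.BirchSwinnertonDyer.Theorems.SignedBaseChangeAnticyclotomicEisensteinDivisibilityCofreeTateDual
import HarnessLib

/-!
# T-42-mult in the kernel, XLIII — P49-KERNEL (1): ASSEMBLY. Greenberg 2006 Thm. 1 / 2016 Prop. 2.6.1
# applied to the cyclotomic deformation `𝒜_S = E[p^∞] ⊗ Λ^*(κ⁻¹)` over `G_{K,S}`; the twisted-coinvariant
# surjectivity (P49′) and Greenberg LNM 1716 Prop. 4.9 MODULO its named inputs {LEO, LOC, Shapiro bridge}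

Cell `bsd-2adic` (run/shared/lean/pub/bsd-2adic/), seat `bsd-2adic-t42` GEN 18 (pen RC-315 (b): «GO — discharge
P49 re-using the Greenberg-2006 engine BY NAME»; memo `t42/DESIGN-T42-ADDENDUM-20/21`). HONEST FRAMING: research
route; THEOREMS ONLY (no `def`, no named fact, no instance, no `sorry`); nothing booked; BSD is not proved by
any of this. PARTITION: X5@2 multiplicative GV-transport rows (K4ᵐ B1·O1; the PRINT binder P49 =
`Greenberg1999.prop49_noFiniteSubmodule_H1Sigma` of `multCongruenceTransportAtTwo_of_print49`, p663002) × p = 2 —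
reduces-the-named-input-of; bears_on K4 items 19922 / 19923 (`--supports stmt-BirchSwinnertonDyer-19923`).

## What this file does (the SKELETON of the discharge; every remaining input is an explicit hypothesis)

For a number field `K`, a prime `p`, a `ℤ_p`-extension `κ` with topological generator `γ`, a finite `S₀` and
`S := S₀ ∪ {v ∣ p}`, an elliptic `W/K` and ANY continuous `ℤ_p`-linear model `ρ₀` of `E[p^∞]` over
`G_{K,S} = Gal(K_S/K)` (`PrimaryTorsion W.geomPoints p`; supplied by the tree's
`SignedBaseChangeAcDivCurveModel.exists_continuousRep_primaryTorsion` when `S ⊇` bad places), let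
`𝒜_S := bigRep (κ.liftUnramifiedOutside S) ρ₀` — Greenberg's `Ind_{K_∞/K} E[p^∞] = E[p^∞] ⊗ Λ^*(κ⁻¹)`, the
tree's co-induced model (`AnticyclotomicBigGaloisRep.lean`), a discrete `Λ = ℤ_p⟦T⟧`-linear continuous
representation of `G_{K,S}` (LNM 1716 Prop. 4.10: `Hⁱ(K_Σ/K, 𝒜) ≅ Hⁱ(K_Σ/K_∞, E[p^∞])`).

* §1 the STANDING hypotheses of the Greenberg-2006 engine for `𝒜_S`, proved: `p`-primary; cofree over `Λ`
  (`BigRepModule.isCofree` + `isCofree_primaryTorsion`), hence cofinitely generated and RFX; the ring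
  `Λ = 𝒪⟦T⟧ ≃ ℤ_p⟦X₀⟧` (`MvPowerSeries.renameEquiv`); `S` finite and `⊇ {v ∣ p}`.
* §2 `exists_int_twistElement_notMem_of_finite` — for every FINITE set of primes of `Λ` of height `≤ 1` there is
  `u ≡ 1 (mod p)` with `θ_u = C(u)·T + C(u − 1)` in none of them (two `θ`'s in one prime `P` force
  `(p, T) ⊆ P`, height `2`).
* §3 **`twist_surjective_of_kernelInputs`** — GRANTED the three Greenberg-2006 named facts (Prop. 5.2, Prop. 6.3,
  Thm. 1 (i): `GlobalH2Structure.lean`), Poitou–Tate 17.13 (a)(b) for `K` (cofinite generation of `H¹`, Greenberg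
  2006 Prop. 3.2 = tree theorem `prop32_of_poitouTate_at`), and the INPUTS (I1) `LEO S 𝒜_S`, (I2) `LOC1` at one
  finite `η ∈ S`, (I3) `LOC2` at every place of `Σ`, (I4) a SHAPIRO BRIDGE `Sh : H¹(G_{K,S}, 𝒜_S) ≃+
  H¹(K_Σ/K_∞, E[p^∞]) = unramifiedOutside (ker κ) E[p^∞] p S₀` intertwining `θ_u` with `u·conj_γ − 1`: the
  engine (`Greenberg2016.isAlmostDivisible_H_one_of_facts`) makes `H¹(G_{K,S}, 𝒜_S)` almost divisible, Greenberg
  2006 Prop. 2.4 (`IsAlmostDivisible.exists_finite_forall_smul_surjective`) makes `θ_u` act ONTO it for the `u`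
  of §2, and the bridge turns this into the twisted-coinvariant surjectivity (P49′) on `H¹(K_Σ/K_∞, E[p^∞])`.
* §4 **`prop49_of_kernelInputs`** — over `ℚ`: if the inputs (I1)–(I4) are available at the binders of Prop. 4.9
  (for some model `ρ₀`), then GRANTED the five named facts `prop49_noFiniteSubmodule_H1Sigma` HOLDS (file XLII's
  brick B1 `prop49_noFiniteSubmodule_H1Sigma_of_twist_surjective`, p664193).

What remains for successors (memo ADDENDUM-21): (I1) = Greenberg's corank count with the real place (LNM 1716
pp. 113–114 / Greenberg 2006 Prop. 4.1 over `ℚ`); (I2) at `η ∋ p`; (I3) at the archimedean place and at `S₀`;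
(I4) from the tree's Shapiro apparatus (`BigRepModule.exists_addEquiv_h1_shapiro`,
`conj_apply_zero_eq_one_add_X_smul`, `RestrictedRamificationDegreeOne`).

References: [GreenbergLNM1716] §4 App., Props. 4.9–4.12, pp. 112–120; [Greenberg2006] Thm. 1, Props. 2.4, 3.2,
4.1, 5.2, 6.3, 6.10, p. 342 (`𝒟 = Ind_{K_∞/K} D`); [Greenberg2016Selmer] Prop. 2.6.1, §4.3; [Harari2020]
Thm. 17.13; [SkinnerUrban2014] Prop. 3.2.3.
-/

set_option autoImplicit false
set_option linter.dupNamespace false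

noncomputable section

open scoped Classical

universe u

namespace Summit.BirchSwinnertonDyer.BirchSwinnertonDyer.Theorems.P49Kernel

open NumberField IsDedekindDomain Field WeierstrassCurve IsLocalRing
  Literature.NumberTheory.EllipticCurves Literature.NumberTheory.EllipticCurves.GreenbergVatsal2000
  Literature.NumberTheory.EllipticCurves.Greenberg1999
  Literature.NumberTheory.GaloisRepresentations Literature.NumberTheory.GaloisCohomology
  Literature.NumberTheory.IwasawaTheory.Greenberg2006 Literature.NumberTheory.IwasawaTheory.Greenberg2016
  Summit.BirchSwinnertonDyer.BirchSwinnertonDyer.Theorems.SignedBaseChangeAcDivCofree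

/-! ## §1. The ring `Λ = ℤ_p⟦T⟧`, the set `S = S₀ ∪ {v ∣ p}`, and the standing hypotheses for `𝒜_S` -/

section Standing

variable (p : ℕ) [Fact p.Prime]

/-- `Λ = ℤ_p⟦T⟧ ≃ ℤ_p⟦X_0⟧` (one variable among `Fin 1`), the shape the Greenberg-2006 engine quantifies over
(`Λ ≃+* MvPowerSeries (Fin m) ℤ_[p]`). [cite: Greenberg2006, §2 p. 346 (Λ a formal power series ring over ℤ_p)] -/
theorem nonempty_ringEquiv_mvPowerSeries_fin_one :
    Nonempty (IwasawaAlgebra p ≃+* MvPowerSeries (Fin 1) ℤ_[p]) :=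
  ⟨(MvPowerSeries.renameEquiv ℤ_[p] finOneEquiv.symm).toRingEquiv⟩

variable {K : Type} [Field K] [NumberField K]

omit [Fact p.Prime] in
/-- `S₀ ∪ {v ∣ p}` is finite (finitely many places divide the non-zero ideal `(p)`).
[cite: GreenbergVatsal2000, §2 p. 23 (Σ = Σ₀ ∪ {p, ∞})] -/
theorem finite_union_setOf_natCast_mem (hp : p ≠ 0) (S₀ : Finset (HeightOneSpectrum (𝓞 K))) :
    ((↑S₀ : Set (HeightOneSpectrum (𝓞 K))) ∪
      {v : HeightOneSpectrum (𝓞 K) | ((p : ℕ) : 𝓞 K) ∈ v.asIdeal}).Finite := by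
  refine S₀.finite_toSet.union ?_
  have hI : Ideal.span {((p : ℕ) : 𝓞 K)} ≠ ⊥ := by
    rw [Ne, Ideal.span_singleton_eq_bot]
    exact_mod_cast hp
  refine (Ideal.finite_factors hI).subset fun v hv ↦ ?_
  rw [Set.mem_setOf_eq, Ideal.dvd_span_singleton]
  exact hv

omit [Fact p.Prime] [NumberField K] in
/-- `S₀ ∪ {v ∣ p} ⊇ {v ∣ p}`. [cite: GreenbergVatsal2000, §2 p. 23] -/
theorem mem_union_setOf_natCast_mem (S₀ : Finset (HeightOneSpectrum (𝓞 K)))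
    (v : HeightOneSpectrum (𝓞 K)) (hv : ((p : ℕ) : 𝓞 K) ∈ v.asIdeal) :
    v ∈ (↑S₀ : Set (HeightOneSpectrum (𝓞 K))) ∪
      {v : HeightOneSpectrum (𝓞 K) | ((p : ℕ) : 𝓞 K) ∈ v.asIdeal} :=
  Or.inr hv

variable (W : WeierstrassCurve K) [W.IsElliptic]

omit [NumberField K] in
/-- **`𝒜 = E[p^∞] ⊗ Λ^*` is COFREE over `Λ = ℤ_p⟦T⟧`** ("`𝒟 = 𝒯 ⊗_Λ Λ̂`, which is a cofree `Λ`-module",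
Greenberg 2006 p. 342): the tree's `BigRepModule.isCofree` (Mahler transform) applied to the cofree `ℤ_p`-module
`E[p^∞]` (`isCofree_primaryTorsion`). [cite: Greenberg2006, p. 342 L4–11] -/
theorem isCofree_bigRepModule :
    IsCofree (IwasawaAlgebra p) (BigRepModule ℤ_[p] p (PrimaryTorsion W.geomPoints p)) :=
  BigRepModule.isCofree (primaryTorsion_exists_pow_nsmul_eq_zero W p) (isCofree_primaryTorsion W p)

omit [NumberField K] in
/-- `𝒜` is cofinitely generated over `Λ`. [cite: Greenberg2006, p. 342 L4–11, §4 p. 367 L33–39] -/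
theorem isCofinitelyGenerated_bigRepModule :
    IsCofinitelyGenerated (IwasawaAlgebra p) (BigRepModule ℤ_[p] p (PrimaryTorsion W.geomPoints p)) :=
  IsCofree.isCofinitelyGenerated (isCofree_bigRepModule p W)

omit [NumberField K] in
/-- RFX(`𝒜`) ("Obviously, RFX(𝒟) is satisfied", Greenberg 2016 §4.3). [cite: Greenberg2016Selmer, §4.3 p. 20 L23] -/
theorem rfx_bigRepModule :
    RFX (IwasawaAlgebra p) (BigRepModule ℤ_[p] p (PrimaryTorsion W.geomPoints p)) :=
  IsCofree.rfx (isCofree_bigRepModule p W)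

omit [NumberField K] [W.IsElliptic] in
/-- `𝒜` is `p`-primary in the `ℤ`-form the engine quantifies over. [cite: Greenberg2006, §4 p. 367 L33–39] -/
theorem exists_pow_zsmul_eq_zero_bigRepModule (Φ : BigRepModule ℤ_[p] p (PrimaryTorsion W.geomPoints p)) :
    ∃ n : ℕ, (p ^ n : ℤ) • Φ = 0 := by
  obtain ⟨k, hk⟩ := BigRepModule.exists_pow_nsmul_eq_zero Φ
  exact ⟨k, by rw [← Int.natCast_pow, natCast_zsmul, hk]⟩

end Standing

/-! ## §2. A twist element `θ_u` outside any finite set of primes of height `≤ 1` -/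

section Twist

variable {p : ℕ} [Fact p.Prime]

/-- **Two twist elements in one prime of height `≤ 1` is impossible.** If `θ_u = C(u)T + C(u−1)` and `θ_{u'}`
(`u ≠ u'`, `u ≡ 1 mod p`) lie in a prime `P` of `Λ = ℤ_p⟦T⟧`, then `u'θ_u − uθ_{u'} = C(u − u') ∈ P` forces
`p ∈ P`, then `C(u−1) ∈ P` and `T ∈ P` (`u` is a unit), so `P ⊇ (p, T) = 𝔪`, of height `2`.
[cite: GreenbergLNM1716, proof of Prop. 4.9, p. 117 ("The `θ_s`'s are irreducible and relatively prime")] -/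
theorem eq_of_twistElement_mem_of_height_le_one (P : PrimeSpectrum (IwasawaAlgebra p))
    (hP : P.asIdeal.height ≤ 1) {u u' : ℤ} (hu : (p : ℤ) ∣ u - 1)
    (hθ : (PowerSeries.C ((u : ℤ_[p])) * PowerSeries.X + PowerSeries.C ((u : ℤ_[p]) - 1) :
      IwasawaAlgebra p) ∈ P.asIdeal)
    (hθ' : (PowerSeries.C ((u' : ℤ_[p])) * PowerSeries.X + PowerSeries.C ((u' : ℤ_[p]) - 1) :
      IwasawaAlgebra p) ∈ P.asIdeal) :
    u = u' := by
  by_contra hne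
  haveI := P.isPrime
  -- `C(u - u') ∈ P`
  have hC : (PowerSeries.C ((u : ℤ_[p]) - u') : IwasawaAlgebra p) ∈ P.asIdeal := by
    have h := P.asIdeal.sub_mem (P.asIdeal.mul_mem_left (PowerSeries.C ((u' : ℤ_[p]))) hθ)
      (P.asIdeal.mul_mem_left (PowerSeries.C ((u : ℤ_[p]))) hθ')
    have heq : (PowerSeries.C ((u' : ℤ_[p])) *
          (PowerSeries.C ((u : ℤ_[p])) * PowerSeries.X + PowerSeries.C ((u : ℤ_[p]) - 1)) -
        PowerSeries.C ((u : ℤ_[p])) *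
          (PowerSeries.C ((u' : ℤ_[p])) * PowerSeries.X + PowerSeries.C ((u' : ℤ_[p]) - 1)) :
          IwasawaAlgebra p) = PowerSeries.C ((u : ℤ_[p]) - u') := by
      simp only [map_sub, map_one]
      ring
    rwa [heq] at h
  -- hence `C(p) ∈ P` (write `u - u' = p^n · unit`)
  have hne' : ((u : ℤ_[p]) - u') ≠ 0 := by
    rw [sub_ne_zero]
    exact_mod_cast hne
  have hp : (PowerSeries.C (p : ℤ_[p]) : IwasawaAlgebra p) ∈ P.asIdeal := by
    have hfac := PadicInt.unitCoeff_spec hne'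
    rw [hfac, map_mul, map_pow] at hC
    rcases P.isPrime.mem_or_mem hC with h | h
    · exact absurd (P.asIdeal.eq_top_of_isUnit_mem h ((PadicInt.unitCoeff hne').isUnit.map _))
        P.isPrime.ne_top
    · exact P.isPrime.mem_of_pow_mem _ h
  -- `C(u - 1) = C(p) · C((u-1)/p) ∈ P`, so `C(u) · X ∈ P`, so `X ∈ P` (`u` is a `p`-adic unit)
  have hu1 : (PowerSeries.C ((u : ℤ_[p]) - 1) : IwasawaAlgebra p) ∈ P.asIdeal := by
    obtain ⟨m, hm⟩ := hu
    have : ((u : ℤ_[p]) - 1) = (p : ℤ_[p]) * (m : ℤ_[p]) := by exact_mod_cast hm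
    rw [this, map_mul]
    exact P.asIdeal.mul_mem_right _ hp
  have hX : (PowerSeries.X : IwasawaAlgebra p) ∈ P.asIdeal := by
    have h1 : (PowerSeries.C ((u : ℤ_[p])) * PowerSeries.X : IwasawaAlgebra p) ∈ P.asIdeal := by
      have := P.asIdeal.sub_mem hθ hu1
      rwa [add_sub_cancel_right] at this
    rcases P.isPrime.mem_or_mem h1 with h | h
    · refine absurd (P.asIdeal.eq_top_of_isUnit_mem h (IsUnit.map _ ?_)) P.isPrime.ne_top
      rw [PadicInt.isUnit_iff]
      by_contra hlt
      have hlt' : ‖((u : ℤ) : ℤ_[p])‖ < 1 := lt_of_le_of_ne (PadicInt.norm_le_one _) hlt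
      rw [PadicInt.norm_int_lt_one_iff_dvd] at hlt'
      have : (p : ℤ) ∣ 1 := by simpa using Int.dvd_sub hlt' hu
      exact (Nat.Prime.one_lt (Fact.out : p.Prime)).ne'
        (by exact_mod_cast Int.eq_one_of_dvd_one (by positivity) this)
    · exact h
  -- `P ⊇ 𝔪`: every element of `𝔪` is `C(a) + X·g` with `a ∈ pℤ_p`
  have hmax : maximalIdeal (IwasawaAlgebra p) ≤ P.asIdeal := by
    intro f hf
    rw [mem_maximalIdeal, mem_nonunits_iff, PowerSeries.isUnit_iff_constantCoeff] at hf
    have hdec := PowerSeries.eq_X_mul_shift_add_const f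
    rw [hdec]
    refine P.asIdeal.add_mem (P.asIdeal.mul_mem_right _ hX) ?_
    -- the constant coefficient is a non-unit of `ℤ_p`, i.e. divisible by `p`
    have hdvd : (p : ℤ_[p]) ∣ PowerSeries.constantCoeff f := by
      rwa [← PadicInt.norm_lt_one_iff_dvd, ← PadicInt.mem_nonunits]
    obtain ⟨c, hc⟩ := hdvd
    rw [hc, map_mul]
    exact P.asIdeal.mul_mem_right _ hp
  have hPeq : P.asIdeal = maximalIdeal (IwasawaAlgebra p) :=
    ((IsLocalRing.maximalIdeal.isMaximal (IwasawaAlgebra p)).eq_of_le P.isPrime.ne_top hmax).symm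
  have h2 := IwasawaAlgebra.height_maximalIdeal p
  rw [← hPeq] at h2
  have : (2 : ℕ∞) ≤ 1 := h2 ▸ hP
  exact absurd this (by decide)

/-- **A twist element outside finitely many primes of height `≤ 1`**: among `u = 1 + p·k`, `k = 0, …, #F`, some
`θ_u` lies in no `P ∈ F` (each `P` contains at most one by `eq_of_twistElement_mem_of_height_le_one`).
[cite: GreenbergLNM1716, proof of Prop. 4.9, p. 117 ("for all but finitely many values of s")] -/
theorem exists_int_twistElement_notMem_of_finite {F : Set (PrimeSpectrum (IwasawaAlgebra p))}
    (hF : F.Finite) (hF1 : ∀ P ∈ F, P.asIdeal.height ≤ 1) :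
    ∃ u : ℤ, (p : ℤ) ∣ u - 1 ∧ ∀ P ∈ F,
      (PowerSeries.C ((u : ℤ_[p])) * PowerSeries.X + PowerSeries.C ((u : ℤ_[p]) - 1) :
        IwasawaAlgebra p) ∉ P.asIdeal := by
  -- for each `P ∈ F` the set of bad `k` has at most one element; a finite union misses some `k ≤ #F`
  let θ : ℤ → IwasawaAlgebra p := fun u ↦
    PowerSeries.C ((u : ℤ_[p])) * PowerSeries.X + PowerSeries.C ((u : ℤ_[p]) - 1)
  let bad : PrimeSpectrum (IwasawaAlgebra p) → Set ℕ := fun P ↦ {k | θ (1 + p * k) ∈ P.asIdeal}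
  have hsub : ∀ P ∈ F, (bad P).Subsingleton := by
    intro P hP k hk k' hk'
    have h := eq_of_twistElement_mem_of_height_le_one P (hF1 P hP) (u := 1 + p * k) (u' := 1 + p * k')
      ⟨k, by ring⟩ hk hk'
    have hp0 : (p : ℤ) ≠ 0 := by exact_mod_cast (Fact.out : p.Prime).ne_zero
    have hkk : (k : ℤ) = k' := mul_left_cancel₀ hp0 (by linarith)
    exact_mod_cast hkk
  have hbadfin : (⋃ P ∈ F, bad P).Finite := hF.biUnion fun P hP ↦ (hsub P hP).finite
  obtain ⟨k, hk⟩ : ∃ k : ℕ, k ∉ ⋃ P ∈ F, bad P := hbadfin.infinite_compl.nonempty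
  refine ⟨1 + p * k, ⟨k, by ring⟩, fun P hP hmem ↦ hk ?_⟩
  exact Set.mem_biUnion hP hmem

end Twist

/-! ## §3. The engine run: almost divisibility of `H¹(G_{K,S}, 𝒜)` and the twisted surjectivity (P49′) -/

section Engine

variable {K : Type} [Field K] [NumberField K] {p : ℕ} [Fact p.Prime]
  [TopologicalSpace (IwasawaAlgebra p)] [DiscreteTopology (IwasawaAlgebra p)] [IsTopologicalRing (IwasawaAlgebra p)]
  (W : WeierstrassCurve K) [W.IsElliptic] (κ : ZpExtension K p) (γ : absoluteGaloisGroup K)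
  (S₀ : Set (HeightOneSpectrum (𝓞 K)))

/-- **(P49′) from the kernel inputs.** `S ⊇ {v ∣ p}` finite, and ANY continuous `Λ`-linear action `ρ` of
`G_{K,S}` on `𝒜 = E[p^∞] ⊗ Λ^*` (`BigRepModule ℤ_[p] p (PrimaryTorsion W.geomPoints p)`; the intended one is
Greenberg's `Ind_{K_∞/K} E[p^∞]`, the tree's `bigRep (κ.liftUnramifiedOutside S) ρ₀`). GRANTED Greenberg 2006
Prop. 5.2 / Prop. 6.3 / Thm. 1 (i) (named facts) and Poitou–Tate 17.13 (a), (b) for `K`, and GIVEN (I1) `LEO S ρ`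
(`Ш²(K, Σ, 𝒜)` cotorsion — Greenberg's corank count), (I2) `LOC1` at a finite `η ∈ S`, (I3) `LOC2` at every place
of `Σ`, (I4) an additive bijection `Sh : H¹(G_{K,S}, 𝒜) ≃+ unramifiedOutside (ker κ) E[p^∞] p S₀` with
`Sh(θ_u • x) = u • conj_γ (Sh x) − Sh x` for every `u : ℤ` (Shapiro, LNM 1716 Prop. 4.10 with "`1 + T ↦ γ`"):
there is `u ≡ 1 (mod p)` such that `c ↦ u • conj_γ c − c` maps `H¹(K_Σ/K_∞, E[p^∞])` ONTO itself. Chain: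
Greenberg 2016 Prop. 2.6.1 (`isAlmostDivisible_H_one_of_facts`; standing hypotheses §1, Prop. 3.2 by
`prop32_of_poitouTate_at`) ⇒ `H¹(G_{K,S}, 𝒜)` almost divisible ⇒ (Prop. 2.4,
`IsAlmostDivisible.exists_finite_forall_smul_surjective`) `π·H¹ = H¹` off finitely many height-`≤ 1` primes ⇒
(§2) some `θ_u` acts onto ⇒ transport along `Sh`.
[cite: GreenbergLNM1716, Props. 4.9, 4.10, pp. 112–117] [cite: Greenberg2006, Thm. 1, Props. 2.4, 3.2, 6.10]
[cite: Greenberg2016Selmer, Prop. 2.6.1, §4.3 p. 20] -/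
theorem twist_surjective_of_kernelInputs
    (h52 : prop52_localH2_torsionBy_injective) (h63 : prop63_shaAway_smul_surjective)
    (hT1 : thm1_sha2_isCoreflexive)
    (hPTb : poitouTate_shaRestricted_tateDual K) (hPTa : poitouTate_restricted_three_le K)
    {S : Set (HeightOneSpectrum (𝓞 K))} (hS : S.Finite)
    (hSp : ∀ v : HeightOneSpectrum (𝓞 K), ((p : ℕ) : 𝓞 K) ∈ v.asIdeal → v ∈ S)
    (ρ : ContinuousRep (GaloisGroupUnramifiedOutside K S) (IwasawaAlgebra p)
      (BigRepModule ℤ_[p] p (PrimaryTorsion W.geomPoints p)))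
    (hLEO : LEO S ρ) {η : HeightOneSpectrum (𝓞 K)} (hη : η ∈ S) (hLOC1 : LOC1 S ρ (Sum.inr η))
    (hLOC2 : ∀ v : Place K, InSigma S v → LOC2 S ρ v)
    (Sh : ρ.H 1 ≃+ unramifiedOutside κ.kerSubgroup (W.geomPrimaryTorsion p) p S₀)
    (hSh : ∀ (u : ℤ) (x : ρ.H 1),
      (Sh ((PowerSeries.C ((u : ℤ_[p])) * PowerSeries.X + PowerSeries.C ((u : ℤ_[p]) - 1) :
          IwasawaAlgebra p) • x) : W.subgroupH1 p κ.kerSubgroup) =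
        u • W.conjH1 p κ.kerSubgroup γ (Sh x) - Sh x) :
    ∃ u : ℤ, (p : ℤ) ∣ u - 1 ∧
      ∀ c ∈ unramifiedOutside κ.kerSubgroup (W.geomPrimaryTorsion p) p S₀,
        ∃ c' ∈ unramifiedOutside κ.kerSubgroup (W.geomPrimaryTorsion p) p S₀,
          u • W.conjH1 p κ.kerSubgroup γ c' - c' = c := by
  obtain ⟨e⟩ := nonempty_ringEquiv_mvPowerSeries_fin_one p
  have hpD := exists_pow_zsmul_eq_zero_bigRepModule p W
  have hD := isCofinitelyGenerated_bigRepModule p W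
  -- cofinite generation of `H¹` (Greenberg 2006 Prop. 3.2, from Poitou–Tate)
  have hfg : IsCofinitelyGenerated (IwasawaAlgebra p) (ρ.H 1) :=
    (prop32_of_poitouTate_at hPTb hPTa S hS hSp e ρ hD).1 1
  -- the engine: `H¹(G_{K,S}, 𝒜)` is almost divisible
  have had : IsAlmostDivisible (IwasawaAlgebra p) (ρ.H 1) :=
    isAlmostDivisible_H_one_of_facts h52 h63 hT1 hS hSp e ρ hpD hD (rfx_bigRepModule p W) hLEO hLOC2 hη
      hLOC1 hfg
  -- Prop. 2.4: `π • H¹ = H¹` off a finite set of primes of height `≤ 1`; pick a twist element off it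
  haveI : IsNoetherianRing (IwasawaAlgebra p) := isNoetherianRing_of_ringEquiv_mvPowerSeries e
  obtain ⟨F, hF, hF1, hdiv⟩ := had.exists_finite_forall_smul_surjective hfg
  obtain ⟨u, hu, huF⟩ := exists_int_twistElement_notMem_of_finite hF hF1
  refine ⟨u, hu, fun c hc ↦ ?_⟩
  obtain ⟨x', hx'⟩ := hdiv _ huF (Sh.symm ⟨c, hc⟩)
  refine ⟨Sh x', (Sh x').2, ?_⟩
  have h := hSh u x'
  simp only at hx'
  rw [hx', AddEquiv.apply_symm_apply] at h
  exact h.symm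

end Engine

/-! ## §4. Over `ℚ`: Greenberg's Prop. 4.9 from the kernel inputs -/

section Rat

/-- **`prop49_noFiniteSubmodule_H1Sigma` from the kernel inputs over `ℚ`.** GRANTED the three Greenberg-2006
named facts and Poitou–Tate 17.13 (a)(b) for `ℚ`: if at the binders of LNM 1716 Prop. 4.9 (`W/ℚ` minimal, `κ`
cyclotomic with topological generator `γ`, `Σ₀` with good reduction outside `Σ₀ ∪ {p}`, `X(E/ℚ_∞)` torsion) there
are a finite `S ⊇ {v ∣ p}`, a continuous `Λ`-linear action `ρ` of `G_{ℚ,S}` on `𝒜 = E[p^∞] ⊗ Λ^*` (discrete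
topology on `Λ`; the intended one is `bigRep (κ.liftUnramifiedOutside S) ρ₀`), with (I1) LEO, (I2) LOC1 at a
finite `η ∈ S`, (I3) LOC2 on `Σ`, and (I4) a Shapiro bridge onto `H¹(ℚ_Σ/ℚ_∞, E[p^∞]) = unramifiedOutside (ker κ)
E[p^∞] p Σ₀` intertwining `θ_u` with `u·conj_γ − 1`, then Prop. 4.9 holds — §3 and brick B1
(`prop49_noFiniteSubmodule_H1Sigma_of_twist_surjective`, p664193). The inputs are exactly what LNM 1716
pp. 113–117 prove (corank count, Lemma 4.11, Prop. 4.10); they are the successors' targets.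
[cite: GreenbergLNM1716, Prop. 4.9 and its proof, pp. 112–118] [cite: Greenberg2006, Thm. 1] [cite: Greenberg2016Selmer, Prop. 2.6.1] -/
theorem prop49_of_kernelInputs
    (h52 : prop52_localH2_torsionBy_injective) (h63 : prop63_shaAway_smul_surjective)
    (hT1 : thm1_sha2_isCoreflexive)
    (hPTb : poitouTate_shaRestricted_tateDual ℚ) (hPTa : poitouTate_restricted_three_le ℚ)
    (hIn : ∀ (W : WeierstrassCurve ℚ) [W.IsElliptic] [W.IsGloballyMinimal] (p : ℕ) [Fact p.Prime]
      (κ : ZpExtension ℚ p) (γ : absoluteGaloisGroup ℚ), κ.IsCyclotomic → κ.IsTopGenerator γ →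
      ∀ (S₀ : Finset (HeightOneSpectrum (𝓞 ℚ))),
        (∀ v : HeightOneSpectrum (𝓞 ℚ), v ∉ S₀ → ((p : ℕ) : 𝓞 ℚ) ∉ v.asIdeal →
          W.HasGoodReductionAt v) →
      ∀ (D : W.SelmerDualData κ γ), D.IsTorsion →
      letI : TopologicalSpace (IwasawaAlgebra p) := ⊥
      ∀ [DiscreteTopology (IwasawaAlgebra p)] [IsTopologicalRing (IwasawaAlgebra p)],
      ∃ (S : Set (HeightOneSpectrum (𝓞 ℚ))) (_ : S.Finite)
        (_ : ∀ v : HeightOneSpectrum (𝓞 ℚ), ((p : ℕ) : 𝓞 ℚ) ∈ v.asIdeal → v ∈ S)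
        (ρ : ContinuousRep (GaloisGroupUnramifiedOutside ℚ S) (IwasawaAlgebra p)
          (BigRepModule ℤ_[p] p (PrimaryTorsion W.geomPoints p)))
        (η : HeightOneSpectrum (𝓞 ℚ))
        (Sh : ρ.H 1 ≃+ unramifiedOutside κ.kerSubgroup (W.geomPrimaryTorsion p) p
          (↑S₀ : Set (HeightOneSpectrum (𝓞 ℚ)))),
        LEO S ρ ∧ η ∈ S ∧ LOC1 S ρ (Sum.inr η) ∧ (∀ v : Place ℚ, InSigma S v → LOC2 S ρ v) ∧
        (∀ (u : ℤ) (x : ρ.H 1),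
          (Sh ((PowerSeries.C ((u : ℤ_[p])) * PowerSeries.X + PowerSeries.C ((u : ℤ_[p]) - 1) :
              IwasawaAlgebra p) • x) : W.subgroupH1 p κ.kerSubgroup) =
            u • W.conjH1 p κ.kerSubgroup γ (Sh x) - Sh x)) :
    prop49_noFiniteSubmodule_H1Sigma := by
  refine prop49_noFiniteSubmodule_H1Sigma_of_twist_surjective ?_
  intro W _ _ p _ κ γ hκ hγ S₀ hbad D hD
  letI : TopologicalSpace (IwasawaAlgebra p) := ⊥
  haveI : DiscreteTopology (IwasawaAlgebra p) := ⟨rfl⟩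
  haveI : ContinuousAdd (IwasawaAlgebra p) := ⟨continuous_of_discreteTopology⟩
  haveI : ContinuousMul (IwasawaAlgebra p) := ⟨continuous_of_discreteTopology⟩
  haveI : ContinuousNeg (IwasawaAlgebra p) := ⟨continuous_of_discreteTopology⟩
  haveI : IsTopologicalRing (IwasawaAlgebra p) := IsTopologicalRing.mk
  obtain ⟨S, hS, hSp, ρ, η, Sh, hLEO, hη, hLOC1, hLOC2, hSh⟩ := hIn W p κ γ hκ hγ S₀ hbad D hD
  exact twist_surjective_of_kernelInputs W κ γ _ h52 h63 hT1 hPTb hPTa hS hSp ρ hLEO hη hLOC1 hLOC2 Sh hSh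

end Rat

end Summit.BirchSwinnertonDyer.BirchSwinnertonDyer.Theorems.P49Kernel

end
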